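import Summits.ResolutionOfSingularities.ResolutionOfSingularities.Theorems.RadicialJungCleanModelsSufficeChartsField
import Literature.AlgebraicGeometry.Resolution.NormalizationInNormal
import Mathlib.RingTheory.Localization.LocalizationLocalization
import Mathlib.RingTheory.Localization.AtPrime.Basic

/-!
# Route `RadicialJung`, crux `CleanModelsSuffice`, line `Sketch`: the stalks of `V^L` as the
# integral closures of the stalks of `V`, compatibly with values in `L`

Helper for the registered stub `stub_charts` of the skeleton of
`Summit.ResolutionOfSingularities.ResolutionOfSingularities.Theses.RadicialJung.CleanModelsSuffice`
(stmt-ResolutionOfSingularities-15883). `RadicialJungCleanResolvesStalks.lean` proves that the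
local ring of `V^L = normalizationIn V L` at a point `x` over `w ∈ V` is (abstractly) isomorphic to
`integralClosure 𝒪_{V,w} L` as soon as the latter is local. To transport Kato's regularity
condition for a CHART along this isomorphism one must know what it does to the germs of the chart
sections; this file re-runs the construction keeping track of that: there is an isomorphism
`e : 𝒪_{V^L,x} ≃ integralClosure 𝒪_{V,w} L` whose composite with the inclusion into `L` is the
canonical map `stalkToField : 𝒪_{V^L,x} → L` of `RadicialJungCleanModelsSufficeChartsField.lean`
(`exists_ringEquiv_stalk_integralClosure`). The proof is that of
`CleanResolves.exists_ringEquiv_stalk_normalizationIn` (Liu 2002, 4.1.2: on an affine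
`U = Spec R ∋ w`, `Γ(V^L, ι⁻¹U) ≅ integralClosure R L`, the stalk is its localisation at the
prime of `x`, integral closure commutes with localisation, and a local integral closure is its
own localisation), with the section isomorphism `sectionsEquiv` whose values in `L` are known.
-/

noncomputable section

set_option linter.dupNamespace false -- mandated namespace of this single-conjunct summit

open CategoryTheory AlgebraicGeometry TopologicalSpace
open Literature.AlgebraicGeometry.Resolution

namespace Summit.ResolutionOfSingularities.ResolutionOfSingularities.Theorems.RadicialJung.CleanModelsSuffice

universe u

attribute [local instance] sectionsAlgebra

/-- **The local rings of `V^L` are the integral closures of the local rings of `V`, compatibly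
with values in `L`.** For a point `x` of `V^L = normalizationIn V L` over `w ∈ V`, with `L` an
`𝒪_{V,w}`-algebra through `K(V)` and `integralClosure 𝒪_{V,w} L` a local ring, there is a ring
isomorphism `e : 𝒪_{V^L,x} ≃ integralClosure 𝒪_{V,w} L` such that `(e z : L) = stalkToField z`
for every germ `z`. [cite: Liu2002, Def. 4.1.24, p. 155] -/
theorem exists_ringEquiv_stalk_integralClosure (Y : Scheme.{u}) [IsIntegral Y] (L : Type u)
    [Field L] [Algebra Y.functionField L] (y' : normalizationIn Y L)
    [Algebra (Y.presheaf.stalk (normalizationInι Y L y')) L]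
    [IsScalarTower (Y.presheaf.stalk (normalizationInι Y L y')) Y.functionField L]
    [IsLocalRing (integralClosure (Y.presheaf.stalk (normalizationInι Y L y')) L)] :
    ∃ e : (normalizationIn Y L).presheaf.stalk y' ≃+*
        integralClosure (Y.presheaf.stalk (normalizationInι Y L y')) L,
      ∀ z, ((e z : integralClosure (Y.presheaf.stalk (normalizationInι Y L y')) L) : L) =
        stalkToField Y L y' z := by
  -- an affine open neighbourhood `U = Spec R` of `y = ι y'`
  obtain ⟨_, ⟨U, hU, rfl⟩, hyU, -⟩ := Y.isBasis_affineOpens.exists_subset_of_mem_open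
    (Set.mem_univ (normalizationInι Y L y')) isOpen_univ
  haveI : Nonempty U := ⟨⟨_, hyU⟩⟩
  haveI : IsScalarTower Γ(Y, U) Y.functionField L := isScalarTower_sectionsAlgebra U
  -- `B = Γ(Y^L, ι⁻¹U) ≅ integralClosure R L =: C`, compatibly with `R` and with values in `L`
  let eB : Γ(normalizationIn Y L, normalizationInι Y L ⁻¹ᵁ U) ≃+* integralClosure Γ(Y, U) L :=
    sectionsEquiv hU
  have heB : ∀ r : Γ(Y, U), eB ((normalizationInι Y L).app U r) =
      algebraMap Γ(Y, U) (integralClosure Γ(Y, U) L) r := sectionsEquiv_app hU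
  -- the primes `𝔮` of `y` in `R` and `𝔮'` of `y'` in `B`, `𝔮' ∩ R = 𝔮`
  have hV : IsAffineOpen (normalizationInι Y L ⁻¹ᵁ U) := hU.preimage (normalizationInι Y L)
  have hyV : y' ∈ normalizationInι Y L ⁻¹ᵁ U := hyU
  obtain ⟨q, hq⟩ : ∃ q : PrimeSpectrum Γ(Y, U), q = hU.primeIdealOf ⟨_, hyU⟩ := ⟨_, rfl⟩
  obtain ⟨q', hq'⟩ : ∃ q' : PrimeSpectrum Γ(normalizationIn Y L, normalizationInι Y L ⁻¹ᵁ U),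
      q' = hV.primeIdealOf ⟨y', hyV⟩ := ⟨_, rfl⟩
  have hqq' : q'.asIdeal.comap ((normalizationInι Y L).app U).hom = q.asIdeal := by
    have h := IsAffineOpen.comap_primeIdealOf_appLE U hU (normalizationInι Y L ⁻¹ᵁ U) hV
      le_rfl hyV
    rw [← Scheme.Hom.app_eq_appLE, ← hq', ← hq] at h
    exact congrArg PrimeSpectrum.asIdeal h
  -- the prime `Q` of `C = integralClosure R L` corresponding to `y'`
  obtain ⟨Q, hQdef⟩ : ∃ Q : Ideal (integralClosure Γ(Y, U) L),
      Q = q'.asIdeal.comap eB.symm.toRingHom := ⟨_, rfl⟩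
  haveI hQ : Q.IsPrime := by rw [hQdef]; exact Ideal.comap_isPrime _ _
  have hmemQ : ∀ x, x ∈ Q ↔ eB.symm x ∈ q'.asIdeal := fun x => by rw [hQdef]; rfl
  have hQq : Q.comap (algebraMap Γ(Y, U) (integralClosure Γ(Y, U) L)) = q.asIdeal := by
    ext r
    constructor
    · intro hr
      have h1 : eB.symm (algebraMap _ _ r) ∈ q'.asIdeal := (hmemQ _).mp (Ideal.mem_comap.mp hr)
      rw [← heB r, RingEquiv.symm_apply_apply] at h1
      have h2 : r ∈ q'.asIdeal.comap ((normalizationInι Y L).app U).hom := Ideal.mem_comap.mpr h1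
      rwa [hqq'] at h2
    · intro hr
      rw [← hqq'] at hr
      have h1 := Ideal.mem_comap.mp hr
      refine Ideal.mem_comap.mpr ((hmemQ _).mpr ?_)
      rw [← heB r, RingEquiv.symm_apply_apply]
      exact h1
  -- `O = 𝒪_{Y,y} = R_𝔮`, and `R → O → L` is `R → L`
  letI algO := TopCat.Presheaf.algebra_section_stalk Y.presheaf (⟨_, hyU⟩ : U)
  haveI hO : IsLocalization.AtPrime (Y.presheaf.stalk (normalizationInι Y L y')) q.asIdeal := by
    rw [hq]; exact hU.isLocalization_stalk ⟨_, hyU⟩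
  haveI hT := functionField_isScalarTower Y U (⟨_, hyU⟩ : U)
  haveI : IsScalarTower Γ(Y, U) (Y.presheaf.stalk (normalizationInι Y L y')) L := by
    refine IsScalarTower.of_algebraMap_eq fun r => ?_
    rw [IsScalarTower.algebraMap_apply (Y.presheaf.stalk (normalizationInι Y L y'))
      Y.functionField L, ← IsScalarTower.algebraMap_apply Γ(Y, U)
      (Y.presheaf.stalk (normalizationInι Y L y')) Y.functionField]
    rfl
  -- the inclusion `C = integralClosure R L ⊆ integralClosure O L`
  let incl : integralClosure Γ(Y, U) L →+*
      integralClosure (Y.presheaf.stalk (normalizationInι Y L y')) L :=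
    { toFun := fun x => ⟨(x : L), IsIntegral.tower_top
          (A := (Y.presheaf.stalk (normalizationInι Y L y') : Type u))
          (show IsIntegral Γ(Y, U) (x : L) from x.2)⟩
      map_one' := rfl
      map_mul' := fun _ _ => rfl
      map_zero' := rfl
      map_add' := fun _ _ => rfl }
  letI algCC := incl.toAlgebra
  haveI : IsScalarTower (integralClosure Γ(Y, U) L)
      (integralClosure (Y.presheaf.stalk (normalizationInι Y L y')) L) L :=
    IsScalarTower.of_algebraMap_eq fun x => rfl
  haveI : IsScalarTower Γ(Y, U) (integralClosure Γ(Y, U) L)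
      (integralClosure (Y.presheaf.stalk (normalizationInι Y L y')) L) :=
    IsScalarTower.of_algebraMap_eq fun r => Subtype.ext rfl
  -- integral closure commutes with localisation
  have hinjRL : Function.Injective (algebraMap Γ(Y, U) L) :=
    (algebraMap Y.functionField L).injective.comp (Y.germToFunctionField_injective U)
  haveI : IsLocalization (Algebra.algebraMapSubmonoid L q.asIdeal.primeCompl) L := by
    refine IsLocalization.of_le_isUnit fun x hx => ?_
    obtain ⟨r, hr, rfl⟩ := hx
    refine (Ne.isUnit ?_ : IsUnit (algebraMap Γ(Y, U) L r))
    rw [map_ne_zero_iff _ hinjRL]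
    rintro rfl
    exact hr (Ideal.zero_mem _)
  haveI hloc := IsLocalization.integralClosure (R := Γ(Y, U)) (S := L)
    (Rf := (Y.presheaf.stalk (normalizationInι Y L y') : Type u)) (Sf := L)
    q.asIdeal.primeCompl
  -- the prime `P = Q · integralClosure O L`
  have hdisj : Disjoint ((Algebra.algebraMapSubmonoid (integralClosure Γ(Y, U) L)
      q.asIdeal.primeCompl : Set (integralClosure Γ(Y, U) L))) (Q : Set _) := by
    rw [Set.disjoint_left]
    rintro _ ⟨r, hr, rfl⟩ hrQ
    exact hr (show r ∈ q.asIdeal by rw [← hQq, Ideal.mem_comap]; exact hrQ)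
  haveI hP : (Q.map (algebraMap (integralClosure Γ(Y, U) L)
      (integralClosure (Y.presheaf.stalk (normalizationInι Y L y')) L))).IsPrime :=
    IsLocalization.isPrime_of_isPrime_disjoint _ _ Q hQ hdisj
  have hPQ : (Q.map (algebraMap (integralClosure Γ(Y, U) L)
      (integralClosure (Y.presheaf.stalk (normalizationInι Y L y')) L))).comap
        (algebraMap _ _) = Q :=
    IsLocalization.under_map_of_isPrime_disjoint _ _ hQ hdisj
  -- `(integralClosure O L)_P` is the localisation of `C` at `Q`
  have hTQ := IsLocalization.isLocalization_isLocalization_atPrime_isLocalization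
    (Algebra.algebraMapSubmonoid (integralClosure Γ(Y, U) L) q.asIdeal.primeCompl)
    (T := Localization.AtPrime (Q.map (algebraMap (integralClosure Γ(Y, U) L)
      (integralClosure (Y.presheaf.stalk (normalizationInι Y L y')) L))))
    (Q.map (algebraMap (integralClosure Γ(Y, U) L)
      (integralClosure (Y.presheaf.stalk (normalizationInι Y L y')) L)))
  have hMQ : (Ideal.comap (algebraMap (integralClosure Γ(Y, U) L)
      (integralClosure (Y.presheaf.stalk (normalizationInι Y L y')) L))
      (Q.map (algebraMap (integralClosure Γ(Y, U) L)
        (integralClosure (Y.presheaf.stalk (normalizationInι Y L y')) L)))).primeCompl =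
      Q.primeCompl := by
    ext x
    change x ∉ _ ↔ x ∉ _
    rw [hPQ]
  change IsLocalization (Ideal.primeCompl _) _ at hTQ
  rw [hMQ] at hTQ
  -- the stalk of `Y^L` at `y'` is the localisation of `B ≅ C` at `𝔮' ↦ Q`
  letI algB := TopCat.Presheaf.algebra_section_stalk (normalizationIn Y L).presheaf
    (⟨y', hyV⟩ : ↥(normalizationInι Y L ⁻¹ᵁ U))
  haveI hst : IsLocalization.AtPrime ((normalizationIn Y L).presheaf.stalk y') q'.asIdeal := by
    rw [hq']; exact hV.isLocalization_stalk ⟨y', hyV⟩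
  have hst' := IsLocalization.isLocalization_of_base_ringEquiv q'.asIdeal.primeCompl
    ((normalizationIn Y L).presheaf.stalk y') eB
  letI algCst : Algebra (integralClosure Γ(Y, U) L) ((normalizationIn Y L).presheaf.stalk y') :=
    ((algebraMap Γ(normalizationIn Y L, normalizationInι Y L ⁻¹ᵁ U)
      ((normalizationIn Y L).presheaf.stalk y')).comp eB.symm.toRingHom).toAlgebra
  have hmap : q'.asIdeal.primeCompl.map eB = Q.primeCompl := by
    ext x
    constructor
    · rintro ⟨z, hz, rfl⟩
      change eB z ∉ Q
      rw [hmemQ]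
      rwa [RingEquiv.symm_apply_apply]
    · intro hx
      refine ⟨eB.symm x, ?_, eB.apply_symm_apply x⟩
      change eB.symm x ∉ q'.asIdeal
      rwa [← hmemQ]
  rw [hmap] at hst'
  haveI : IsLocalization.AtPrime ((normalizationIn Y L).presheaf.stalk y') Q := hst'
  -- maximality of `P`: it lies over the maximal ideal of `O`, so it IS the maximal ideal
  have hPmax : (Q.map (algebraMap (integralClosure Γ(Y, U) L)
      (integralClosure (Y.presheaf.stalk (normalizationInι Y L y')) L))).IsMaximal := by
    refine Ideal.isMaximal_of_isIntegral_of_isMaximal_comap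
      (R := (Y.presheaf.stalk (normalizationInι Y L y') : Type u)) _ ?_
    have hunder : ((Q.map (algebraMap (integralClosure Γ(Y, U) L)
        (integralClosure (Y.presheaf.stalk (normalizationInι Y L y')) L))).comap
        (algebraMap (Y.presheaf.stalk (normalizationInι Y L y')) _)).comap
        (algebraMap Γ(Y, U) (Y.presheaf.stalk (normalizationInι Y L y'))) = q.asIdeal := by
      rw [Ideal.comap_comap, ← hQq]
      conv_rhs => rw [← hPQ, Ideal.comap_comap]
      congr 1
      refine RingHom.ext fun r => Subtype.ext ?_
      exact (IsScalarTower.algebraMap_apply Γ(Y, U)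
        (Y.presheaf.stalk (normalizationInι Y L y')) L r).symm
    have key : (Q.map (algebraMap (integralClosure Γ(Y, U) L)
        (integralClosure (Y.presheaf.stalk (normalizationInι Y L y')) L))).comap
        (algebraMap (Y.presheaf.stalk (normalizationInι Y L y')) _) =
        IsLocalRing.maximalIdeal (Y.presheaf.stalk (normalizationInι Y L y')) := by
      rw [← IsLocalization.map_under q.asIdeal.primeCompl
        (Y.presheaf.stalk (normalizationInι Y L y')) ((Q.map _).comap _), Ideal.under_def, hunder]
      exact IsLocalization.AtPrime.map_eq_maximalIdeal q.asIdeal _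
    rw [key]
    exact IsLocalRing.maximalIdeal.isMaximal _
  set P := Q.map (algebraMap (integralClosure Γ(Y, U) L)
      (integralClosure (Y.presheaf.stalk (normalizationInι Y L y')) L)) with hPdef
  have hPm : P = IsLocalRing.maximalIdeal _ := IsLocalRing.eq_maximalIdeal hPmax
  have HP : P.primeCompl ≤ IsUnit.submonoid
      (integralClosure (Y.presheaf.stalk (normalizationInι Y L y')) L) := by
    intro x hx
    have hx' : x ∉ IsLocalRing.maximalIdeal _ := hPm ▸ hx
    exact IsLocalRing.notMem_maximalIdeal.mp hx'
  -- the two isomorphisms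
  let e₁ := IsLocalization.algEquiv Q.primeCompl ((normalizationIn Y L).presheaf.stalk y')
    (Localization.AtPrime P)
  let e₂ := IsLocalization.atUnits (integralClosure (Y.presheaf.stalk (normalizationInι Y L y')) L)
    P.primeCompl (S := Localization.AtPrime P) HP
  refine ⟨e₁.toRingEquiv.trans e₂.symm.toRingEquiv, ?_⟩
  -- compatibility with values in `L`: both sides are ring maps out of a localisation of `B`
  have hB : ∀ σ : Γ(normalizationIn Y L, normalizationInι Y L ⁻¹ᵁ U),
      (((e₁.toRingEquiv.trans e₂.symm.toRingEquiv)
        ((normalizationIn Y L).presheaf.germ (normalizationInι Y L ⁻¹ᵁ U) y' hyV σ) :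
          integralClosure (Y.presheaf.stalk (normalizationInι Y L y')) L) : L) =
        stalkToField Y L y' ((normalizationIn Y L).presheaf.germ (normalizationInι Y L ⁻¹ᵁ U) y' hyV σ) := by
    intro σ
    have h1 : (normalizationIn Y L).presheaf.germ (normalizationInι Y L ⁻¹ᵁ U) y' hyV σ =
        algebraMap (integralClosure Γ(Y, U) L) ((normalizationIn Y L).presheaf.stalk y') (eB σ) := by
      change _ = algebraMap Γ(normalizationIn Y L, normalizationInι Y L ⁻¹ᵁ U)
        ((normalizationIn Y L).presheaf.stalk y') (eB.symm (eB σ))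
      rw [RingEquiv.symm_apply_apply]
      rfl
    have h2 : e₁ (algebraMap (integralClosure Γ(Y, U) L) ((normalizationIn Y L).presheaf.stalk y')
        (eB σ)) = algebraMap _ (Localization.AtPrime P) (eB σ) := e₁.commutes _
    have h3 : algebraMap (integralClosure Γ(Y, U) L) (Localization.AtPrime P) (eB σ) =
        algebraMap (integralClosure (Y.presheaf.stalk (normalizationInι Y L y')) L)
          (Localization.AtPrime P) (incl (eB σ)) :=
      IsScalarTower.algebraMap_apply _ _ _ _
    have h4 : e₂.symm (algebraMap (integralClosure (Y.presheaf.stalk (normalizationInι Y L y')) L)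
        (Localization.AtPrime P) (incl (eB σ))) = incl (eB σ) := by
      rw [AlgEquiv.symm_apply_eq]
      exact (e₂.commutes _).symm
    rw [stalkToField_germ, ← coe_sectionsEquiv hU]
    change ((e₂.symm (e₁ ((normalizationIn Y L).presheaf.germ (normalizationInι Y L ⁻¹ᵁ U) y' hyV σ)) :
      integralClosure (Y.presheaf.stalk (normalizationInι Y L y')) L) : L) = ((eB σ : _) : L)
    rw [h1, h2, h3, h4]
    rfl
  intro z
  let F : (normalizationIn Y L).presheaf.stalk y' →+* L :=
    (integralClosure (Y.presheaf.stalk (normalizationInι Y L y')) L).val.toRingHom.comp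
      (e₁.toRingEquiv.trans e₂.symm.toRingEquiv).toRingHom
  have hFG : F = stalkToField Y L y' := by
    refine IsLocalization.ringHom_ext q'.asIdeal.primeCompl
      (S := (normalizationIn Y L).presheaf.stalk y') ?_
    refine RingHom.ext fun σ => ?_
    exact hB σ
  exact congrArg (fun φ : (normalizationIn Y L).presheaf.stalk y' →+* L => φ z) hFG

/-- **The local rings of `V^L` are the integral closures of the local rings of `V`, compatibly
with values in `L`** (universe-`0` form, the registered interface of this helper file).
[cite: Liu2002, Def. 4.1.24, p. 155] -/
theorem exists_ringEquiv_stalk_integralClosure_zero (Y : Scheme.{0}) [IsIntegral Y] (L : Type)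
    [Field L] [Algebra Y.functionField L] (y' : normalizationIn Y L)
    [Algebra (Y.presheaf.stalk (normalizationInι Y L y')) L]
    [IsScalarTower (Y.presheaf.stalk (normalizationInι Y L y')) Y.functionField L]
    [IsLocalRing (integralClosure (Y.presheaf.stalk (normalizationInι Y L y')) L)] :
    ∃ e : (normalizationIn Y L).presheaf.stalk y' ≃+*
        integralClosure (Y.presheaf.stalk (normalizationInι Y L y')) L,
      ∀ z, ((e z : integralClosure (Y.presheaf.stalk (normalizationInι Y L y')) L) : L) =
        stalkToField Y L y' z :=
  exists_ringEquiv_stalk_integralClosure Y L y'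

end Summit.ResolutionOfSingularities.ResolutionOfSingularities.Theorems.RadicialJung.CleanModelsSuffice

end
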